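import Summits.CriticalPhenomena.PercolationContinuityZ3.Theorems.PercNearOneGluingNoHeavyLowerTailIncStarSlackEdgeBase
import Summits.CriticalPhenomena.PercolationContinuityZ3.Theorems.PercNearOneGluingNoHeavyLowerTailIncStarRootStarTwoStep
import HarnessLib

/-!
# The DUAL-REVELATION schema for the increasing star (prim-sahi-p2 gen 17)

Support file (`--supports stmt-CriticalPhenomena-4575`).  No definitions, no named facts, no sorries; standard axioms.
Memo `run/shared/lean/prim/prim-sahi/FROM-prim-sahi-p2-gen17-MQ-REFUTED-HITTING-C3.md` §4bis, `prim-sahi-p2/PROOF-E3.md` §27h.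

Let `T(w; s) = E₃({s↔b},{s↔c},{s↔y})` under `prodBernoulli w`.  Gen 16's ROOT-STAR mixture conjecture `(MQ)` (condition on the root pairs;
`…IncStarRootStarMixture`) is FALSE (gen 17: a near-sure root pair reduces it to a root-pair chord).  Its exact DUAL conditions on the
COMPLEMENT of the root star: with `F` the set of fractional non-loop pairs NOT containing `s` and, for `O ⊆ F`, `w^O` the weight pinning `O`
open and `F ∖ O` closed, the law is the mixture `Σ_O π(O)·prodBernoulli w^O` (`IncStar.real_eq_sum_rootStarMixture`, any `F`), and under each
`w^O` the graph `G − s` is DETERMINISTIC, so `T(w^O; s) ≥ 0` is the proved base case `IncStar.incStar_nonneg_of_nonRootDet` ("star of blocks").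
Hence the dual-revelation inequality

  `(D′)   Σ_{O ⊆ F} π(O) · T(w^O; s) ≤ T(w; s)`     ("revealing all non-root pairs never raises Sahi's cubic on average")

implies the increasing star AT ONCE, with no induction (`incStar_nonneg_of_dualRevelation_at`, pointwise; `incStar_nonneg_of_dualRevelation`,
global).  `(D′)` is (MQ) with the two factors of `Ω = 2^{star(s)} × 2^{E(G−s)}` exchanged; numerically it has no known failure (gen 17: ≈ 3 700
targeted cases incl. every gadget that kills (MQ); equality on trees) but it is an AVERAGED statement and therefore on the census watch-list, not a
theorem.  Nothing here asserts `(D′)`; it is the hypothesis.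
-/

noncomputable section

namespace Summit.CriticalPhenomena.PercolationContinuityZ3.Theorems

namespace IncStar

open Finset MeasureTheory Literature.Probability.Percolation Literature.Probability.LatticeModels EdgeInduction
open scoped Classical

variable {n : ℕ}

/-- Pinning every fractional non-loop pair avoiding `s` (to `1` on `O`, to `0` on the rest of `F`) leaves `G − s` deterministic: every
non-loop pair avoiding `s` has pinned weight `0` or `1`. [this work] -/
theorem nonRootDet_of_pin (w : Sym2 (Fin n) → unitInterval) (s : Fin n) (O : Finset (Sym2 (Fin n))) :
    ∀ e : Sym2 (Fin n), ¬ e.IsDiag → s ∉ e →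
      (fun f => if f ∈ O then (1 : unitInterval)
        else if f ∈ ((fracEdges w).filter fun f => ¬ f.IsDiag ∧ s ∉ f) then 0 else w f) e = 0 ∨
      (fun f => if f ∈ O then (1 : unitInterval)
        else if f ∈ ((fracEdges w).filter fun f => ¬ f.IsDiag ∧ s ∉ f) then 0 else w f) e = 1 := by
  intro e hd hs
  by_cases heO : e ∈ O
  · right; simp [heO]
  · by_cases heF : e ∈ ((fracEdges w).filter fun f => ¬ f.IsDiag ∧ s ∉ f)
    · left; simp [heO, heF]
    · have hnf : e ∉ fracEdges w := by
        intro h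
        exact heF (Finset.mem_filter.2 ⟨h, hd, hs⟩)
      rcases eq_zero_or_one_of_not_mem_fracEdges hnf with h0 | h1
      · left; simp [heO, heF, h0]
      · right; simp [heO, heF, h1]

/-- **Dual revelation, pointwise.**  If Sahi's cubic of the star at `s` dominates its mixture over the pinnings of all fractional non-loop
pairs AVOIDING `s` (i.e. `E₃ ≥ E[E₃ | configuration of G − s]`), then it is nonnegative — because every pinned term is the star of a graph whose
non-root part is deterministic (`incStar_nonneg_of_nonRootDet`). [this work] -/
theorem incStar_nonneg_of_dualRevelation_at (w : Sym2 (Fin n) → unitInterval) (s b c y : Fin n)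
    (h : ∑ O ∈ ((fracEdges w).filter fun e => ¬ e.IsDiag ∧ s ∉ e).powerset,
          (∏ e ∈ O, (w e : ℝ)) * (∏ e ∈ ((fracEdges w).filter fun e => ¬ e.IsDiag ∧ s ∉ e) \ O, (1 - (w e : ℝ))) *
            sahiE3 (prodBernoulli (fun e => if e ∈ O then (1 : unitInterval)
                else if e ∈ ((fracEdges w).filter fun e => ¬ e.IsDiag ∧ s ∉ e) then 0 else w e))
              (openConn s b) (openConn s c) (openConn s y) ≤
        sahiE3 (prodBernoulli w) (openConn s b) (openConn s c) (openConn s y)) :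
    0 ≤ sahiE3 (prodBernoulli w) (openConn s b) (openConn s c) (openConn s y) := by
  refine le_trans ?_ h
  refine Finset.sum_nonneg fun O _ => ?_
  have hp1 : 0 ≤ ∏ e ∈ O, (w e : ℝ) := Finset.prod_nonneg fun e _ => (w e).2.1
  have hp2 : 0 ≤ ∏ e ∈ ((fracEdges w).filter fun e => ¬ e.IsDiag ∧ s ∉ e) \ O, (1 - (w e : ℝ)) :=
    Finset.prod_nonneg fun e _ => sub_nonneg.2 (w e).2.2
  exact mul_nonneg (mul_nonneg hp1 hp2) (incStar_nonneg_of_nonRootDet _ s b c y (nonRootDet_of_pin w s O))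

/-- **DUAL-REVELATION SCHEMA.**  If `(D′)` holds at every root of every weight on `Fin n` — Sahi's cubic of the star dominates its mixture over
the pinnings of the fractional non-loop pairs avoiding the root — then the increasing star `E₃({s↔b},{s↔c},{s↔y}) ≥ 0` holds for every weight
on `Fin n` and all `s b c y`.  No induction: the dual of `incStar_nonneg_of_rootStarMixture`. [this work] -/
theorem incStar_nonneg_of_dualRevelation
    (h : ∀ (w : Sym2 (Fin n) → unitInterval) (s b c y : Fin n),
      ∑ O ∈ ((fracEdges w).filter fun e => ¬ e.IsDiag ∧ s ∉ e).powerset,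
          (∏ e ∈ O, (w e : ℝ)) * (∏ e ∈ ((fracEdges w).filter fun e => ¬ e.IsDiag ∧ s ∉ e) \ O, (1 - (w e : ℝ))) *
            sahiE3 (prodBernoulli (fun e => if e ∈ O then (1 : unitInterval)
                else if e ∈ ((fracEdges w).filter fun e => ¬ e.IsDiag ∧ s ∉ e) then 0 else w e))
              (openConn s b) (openConn s c) (openConn s y) ≤
        sahiE3 (prodBernoulli w) (openConn s b) (openConn s c) (openConn s y)) :
    ∀ (w : Sym2 (Fin n) → unitInterval) (s b c y : Fin n),
      0 ≤ sahiE3 (prodBernoulli w) (openConn s b) (openConn s c) (openConn s y) :=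
  fun w s b c y => incStar_nonneg_of_dualRevelation_at w s b c y (h w s b c y)

/-- The mixture in `(D′)` IS the law: `P(X) = Σ_O π(O) · P_{w^O}(X)` for the pinning set `F` of fractional non-loop pairs avoiding `s`
(specialisation of `real_eq_sum_rootStarMixture`), so `(D′)` compares `E₃` of the law with the average of `E₃` over its conditional laws given the
configuration of `G − s`. [this work] -/
theorem real_eq_sum_nonRootMixture (w : Sym2 (Fin n) → unitInterval) (s : Fin n) (X : Set (BondConfig (Fin n))) :
    (prodBernoulli w).real X =
      ∑ O ∈ ((fracEdges w).filter fun e => ¬ e.IsDiag ∧ s ∉ e).powerset,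
        (∏ f ∈ O, (w f : ℝ)) * (∏ f ∈ ((fracEdges w).filter fun e => ¬ e.IsDiag ∧ s ∉ e) \ O, (1 - (w f : ℝ))) *
          (prodBernoulli (fun f => if f ∈ O then (1 : unitInterval)
            else if f ∈ ((fracEdges w).filter fun e => ¬ e.IsDiag ∧ s ∉ e) then 0 else w f)).real X :=
  real_eq_sum_rootStarMixture w _ X

/-! ## Addendum (prim-sahi-p2 gen 18, 2026-08-23; referee R625): CORRECTION — `(D′)` is NOT an equality on trees

The header's parenthesis "(… equality on trees)" is WRONG and is withdrawn.  `(D′)` holds with equality only on a thin locus (root stars;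
spiders `K_{1,3}` behind a hub; more generally when the revealed non-root configuration is 'cubically uncorrelated' with the target events),
not on all trees: for the path `s – 1 – 2` with all three pair weights `1/2` and targets `(2,2,2)` the slack is
`T(w; s) − Σ_O π(O)·T(w^O; s) = 9/64` (`T = 21/64`); targets `(1,2,2)` give `3/32`; the two-level tree `s–5–4–{1,2}`, `5–3` with targets `(1,2,3)`
gives `3/256` (exact enumeration, `prim-sahi-p2/gen18/py/reveng.py`; `prim-sahi-p2/PROOF-E3.md` §28e).  For a root of degree one with root pair
weight `p` the slack is `p²·[(1−p)·Σ_cyc Cov′(Y_a, Y_bY_c) + p·E₃′]` (`Y_t = {r ↔ t}` in `G − s`, `E₃′` = the star of `G − s` at the root's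
neighbour `r`), which vanishes iff `E₃′ = 0` and the three covariances vanish.  Nothing in the Lean content of this file changes: `(D′)` is a
hypothesis here, never asserted; its numerical status (no known failure; gen 18: closed under the gadget calculus that refuted `(MQ)`, minimum of the
revelation family `Ψ(S) ≤ Ψ(T)` for `S ⊆ T ⊆` non-root pairs by the laminar chord theorem `SahiHitting.sahiE3_hitting_laminar_chord`) is recorded in
`PROOF-E3.md` §28b–§28f and memo `FROM-prim-sahi-p2-gen18-REVELATION-CALCULUS-FOREST-CONCAVITY.md`.
-/

end IncStar

end Summit.CriticalPhenomena.PercolationContinuityZ3.Theorems
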